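import Summits.BirchSwinnertonDyer.BirchSwinnertonDyer.Theorems.EisensteinPrimesB11L3Door
import HarnessLib

/-!
# Row B11 = cell X2c (rank 1, Eisenstein, `p ‖ N`): the lever-L3 certificate ALSO gives MAZUR'S MAIN
# CONJECTURE AT THE PAIR — parity-free, sign-free, λ-free (cell `bsd-eis`, seat `bsd-eis-k5-p3` gen 2;
# route `EisensteinPrimes`, crux 4 `BSDpOnCellC` = stmt-BirchSwinnertonDyer-19034; THEOREMS ONLY)

HONEST FRAMING (FULL-BSD rank-≤1 programme D-0033, cell `bsd-eis`, home `run/shared/lean/pub/bsd-eis/`).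
Nothing is booked here and no label or count moves: X2c stays CONSTRUCTION-SHAPED as a class; neither
`BSDpOnCellC` nor `MazurMCOnCellB` (the CLASSES) is claimed; BSD is proved for no curve unconditionally.
Every published theorem enters as one of the tree's existing NAMED FACTS, taken as a hypothesis:
Wuthrich 2014 Thm. 16 (`hWu`), Stein–Wuthrich 2013 Thm. 6.1 (`hJs` / `hJn`), Gross–Zagier–Kolyvagin
(`hGZK`) — all binders of the K5 route's `PublishedInputs`; NO new class-level input, no `_OPEN` fact.

THE POINT (the rank-ONE companion of k5-c3's rank-zero `X2/MainConjectureConverse.lean` and the converse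
of b2b's `X2.certificate_iff_schneider_and_bsdp_of_mazurMainConjectureAt_{split,nonsplit}`). Lever L3
(`B11L3.bsdp_of_cellC_of_{split,not_split}_of_thm16_of_l3Certificate`, p534013) reads, for THE
Mazur–Tate–Teitelbaum function `L` and THE Stein–Wuthrich §4.2 height `Dh` of a rank-one X2 pair,
`ord_{T=0} L = r + e` and `v_p(ϖ·[T^(r+e)]L·B) = v_p(A·Reg_p(E,Dh))` (`e = 1`, `A = 𝓛_p·∏c_v`,
`B = log_p(γ_cyc)²·#tors²` split; `e = 0`, `A = 2·∏c_v`, `B = log_p(γ_cyc)·#tors²` non-split), and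
concludes `BSD(E,p)`. Run Wuthrich's one-sided divisibility `ϖ·L = T^e·ι(h·f_E)` (`h ∈ Λ` the Kato
cofactor, `f_E` a generator of `char_Λ X(E/ℚ_∞)`) through the same two readings: `[T^(r+e)]` of both
sides gives `ϖ·[T^(r+e)]L = h(0)·[T^r]f_E`; the order reading forces `[T^r]f_E ≠ 0`, i.e.
`ord_{T=0} f_E = r`, whence (SW13 Thm. 6.1 clause 2) Schneider's conjecture for `Dh` and `#Ш[p^∞] < ∞`,
and (clause 3) `[T^r]f_E·B = u·A·Reg_p·#Ш[p^∞]`, `u ∈ ℤ_pˣ`; so the valuation reading says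
`v_p(h(0)) + v_p(#Ш[p^∞]) = 0` with both terms `≥ 0`: **`h(0) ∈ ℤ_pˣ`, hence `h ∈ Λˣ`** — which is
the tree's `X2.MazurMainConjectureAt W p` VERBATIM (`char_Λ X · T^e = (ϖ·L)` up to a unit of `Λ`, both
clauses, `w := h`). So at every rank-one X2 pair:

  **L3 certificate ⟹ Mazur's cyclotomic main conjecture at `(E,p)` (with the trivial-zero clause)
  AND Schneider(Dh) AND `Ш(E/ℚ)[p^∞] = 0`** — no Greenberg–Vatsal parity, no `(μ,λ)` reading, no
  relative / congruence partner, no anticyclotomic object, no `#Ш_an`; the SAME two instrument readings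
  that book `BSD(E,p)` on lever L3 (cell road «B11-L3CW» / L3W1a) certify the main conjecture at the
  pair, in particular at the ψ-EVEN (`¬GVPar`) pairs where no published theorem supplies it
  (Greenberg–Vatsal needs the parity; Keller–Yin Thm. D′ is a preprint).

In print this is the Stein–Wuthrich «unit quotient» remark (Math. Comp. 82 (2013), after Thm. 6.1 /
§8: same order of vanishing and same leading valuation ⇒ the Kato quotient is a unit in `ℤ_p⟦T⟧`), run on
Wuthrich's REDUCIBLE-case divisibility (Doc. Math. 19 (2014) Thm. 16) instead of Kato's surjective one;
beyond-print theorem: NO (instance-level, conditional on readings) — beyond-print COVERAGE: the ψ-even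
multiplicative Eisenstein rank-one pairs.

Contents: §1 `isUnit_cofactor_of_leadingTerm_certificate` (pure algebra: the `p`-adic certificate
engine `Typed.padicValNat_card_shaPrimary_le_of_leadingTerm_shape` run to EQUALITY: the cofactor is a
unit and `ord_{T=0} f_E = r`); §2 `mazurMainConjectureAt_of_thm16_of_l3Certificate_{split,nonsplit}`
(raw hypotheses); §3 the cell forms on `X2.CellC W p` with EXACTLY the `hcert` binder of the p534013
doors, and the conjunctions `bsdp_and_mazurMainConjectureAt_of_cellC_of_{split,not_split}_…`.

References: [Wuthrich2014] Thm. 16 (p. 397); [SteinWuthrich2013] Thm. 6.1 (p. 20), §3.1 (p. 9), §4.2,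
§8.2 (p. 24); [GreenbergVatsal2000] p. 4 (after Thm. (1.2)); [MazurTateTeitelbaum1986] §I.14;
[Miller2011LMS] Def. 1.1, Prop. 7.6; tree: `X2/MainConjectureConverse.lean` (rank 0, k5-c3 g6),
`X2/RankOneCertificateExact.lean` (MC ⟹ certificate exact, b2b gen 5), `Iwasawa/UnitCoefficientCertificateMultiplicative.lean`
(unit-coefficient certificate ⟹ MC, surjective image, b2b iw-1).
-/

set_option autoImplicit false
set_option linter.dupNamespace false

noncomputable section

open scoped Classical MatrixGroups ModularForm

open WeierstrassCurve PowerSeries CongruenceSubgroup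
  Literature.NumberTheory.EllipticCurves
  Literature.NumberTheory.EllipticCurves.ModularForms
  Literature.NumberTheory.EllipticCurves.Rank1Residual
  Literature.NumberTheory.EllipticCurves.Rank1Residual.Typed
  Literature.NumberTheory.EllipticCurves.Wuthrich2014
  Literature.NumberTheory.EllipticCurves.SteinWuthrich2013
  Summit.BirchSwinnertonDyer.Rank1Residual
  Summit.BirchSwinnertonDyer.Rank1Residual.X2

namespace Summit.BirchSwinnertonDyer.BirchSwinnertonDyer.Theorems.B11L3

variable (W : WeierstrassCurve ℚ) [W.IsElliptic] [W.IsGloballyMinimal] (p : ℕ) [Fact p.Prime]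

/-! ## §1 The certificate engine run to EQUALITY: the Kato cofactor is a unit -/

omit [W.IsElliptic] [W.IsGloballyMinimal] in
/-- **The `p`-adic certificate engine, equality form.** Data as in
`Typed.padicValNat_card_shaPrimary_le_of_leadingTerm_shape` with the cofactor explicit: `f_E, h ∈ Λ`,
`c ≠ 0`, `c·L = T^e·ι(h·f_E)`, `T^k ∣ f_E`, the leading-term shape at order `k` (available once
`ord_{T=0} f_E = k`), and the two readings `ord_{T=0} L = k + e`, `v_p(c·[T^(k+e)]L·B) = v_p(A·R)`.
Then `h` is a UNIT of `Λ = ℤ_p⟦T⟧` and `ord_{T=0} f_E = k` (the defect `v_p h(0) + v_p #Ш[p^∞]` of the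
divisibility-only engine is `0`). Pure algebra. [cite: SteinWuthrich2013, Thm. 6.1 (p. 20) and §8.2 (p. 24)] -/
theorem isUnit_cofactor_of_leadingTerm_certificate (fE h : IwasawaAlgebra p)
    (L : PowerSeries ℚ_[p]) (c : ℚ_[p]) (hc : c ≠ 0) (e k : ℕ)
    (hι : PowerSeries.C c * L = PowerSeries.X ^ e * iwasawaToPowerSeries p (h * fE))
    (hordL : L.order = ((k + e : ℕ) : ℕ∞)) (A B R : ℚ_[p]) (hA : A ≠ 0)
    (hXk : (PowerSeries.X : IwasawaAlgebra p) ^ k ∣ fE)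
    (hLT : fE.order = (k : ℕ) →
      Finite (AddCommGroup.primaryComponent W.sha p) ∧ R ≠ 0 ∧
        ∃ u : ℤ_[p]ˣ, ((PowerSeries.coeff k fE : ℤ_[p]) : ℚ_[p]) * B =
          ((u : ℤ_[p]) : ℚ_[p]) *
            (A * R * (Nat.card (AddCommGroup.primaryComponent W.sha p) : ℚ_[p])))
    (hcert : (c * PowerSeries.coeff (k + e) L * B).valuation = (A * R).valuation) :
    IsUnit h ∧ fE.order = (k : ℕ) := by
  obtain ⟨q, hq⟩ := hXk
  -- the order reading: `[T^(k+e)]L ≠ 0`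
  have hcoeffL : PowerSeries.coeff (k + e) L ≠ 0 := by
    have hL0 : L ≠ 0 := by
      intro h0
      rw [h0, PowerSeries.order_zero] at hordL
      exact ENat.top_ne_coe _ hordL
    have h1 := PowerSeries.coeff_order hL0
    rwa [hordL, ENat.toNat_coe] at h1
  -- `c·[T^(k+e)]L = h(0)·q(0)`, `[T^k]f_E = q(0)`
  have hcoeff_g : (PowerSeries.coeff k (h * fE) : ℤ_[p]) =
      PowerSeries.constantCoeff h * PowerSeries.constantCoeff q := by
    rw [hq, show h * (PowerSeries.X ^ k * q) = PowerSeries.X ^ k * (h * q) by ring,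
      PowerSeries.coeff_X_pow_mul', if_pos le_rfl, Nat.sub_self,
      PowerSeries.coeff_zero_eq_constantCoeff, map_mul]
  have hcoeff_fE : (PowerSeries.coeff k fE : ℤ_[p]) = PowerSeries.constantCoeff q := by
    rw [hq, PowerSeries.coeff_X_pow_mul', if_pos le_rfl, Nat.sub_self,
      PowerSeries.coeff_zero_eq_constantCoeff]
  have hcoeff_cL : c * PowerSeries.coeff (k + e) L =
      ((PowerSeries.coeff k (h * fE) : ℤ_[p]) : ℚ_[p]) := by
    have h1 : PowerSeries.coeff (k + e) (PowerSeries.C c * L) = c * PowerSeries.coeff (k + e) L :=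
      PowerSeries.coeff_C_mul _ _ _
    have h2 : PowerSeries.coeff (k + e) (PowerSeries.X ^ e * iwasawaToPowerSeries p (h * fE)) =
        ((PowerSeries.coeff k (h * fE) : ℤ_[p]) : ℚ_[p]) := by
      rw [PowerSeries.coeff_X_pow_mul', if_pos (Nat.le_add_left e k), Nat.add_sub_cancel,
        iwasawaToPowerSeries, PowerSeries.coeff_map]
      rfl
    rw [← h1, hι, h2]
  have hg_k_ne : (PowerSeries.coeff k (h * fE) : ℤ_[p]) ≠ 0 := by
    intro h0
    have : ((PowerSeries.coeff k (h * fE) : ℤ_[p]) : ℚ_[p]) = 0 := by rw [h0]; rfl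
    rw [← hcoeff_cL] at this
    exact (mul_ne_zero hc hcoeffL) this
  have hh0 : PowerSeries.constantCoeff h ≠ 0 := by
    intro h0; apply hg_k_ne; rw [hcoeff_g, h0, zero_mul]
  have hq0 : PowerSeries.constantCoeff q ≠ 0 := by
    intro h0; apply hg_k_ne; rw [hcoeff_g, h0, mul_zero]
  -- hence `ord_{T=0} f_E = k`, and the leading-term shape applies
  have hordfE : fE.order = (k : ℕ) := by
    refine le_antisymm (PowerSeries.order_le k (by rw [hcoeff_fE]; exact hq0)) ?_
    refine PowerSeries.le_order fE k (fun i hi => ?_)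
    have hik : ¬ k ≤ i := not_le.mpr (by exact_mod_cast hi)
    rw [hq, PowerSeries.coeff_X_pow_mul', if_neg hik]
  obtain ⟨hfin, hR, u, hu⟩ := hLT hordfE
  haveI := hfin
  -- `c·[T^(k+e)]L·B = h(0)·u·(A·R)·#Ш[p^∞]` in `ℚ_p`
  set h0 : ℚ_[p] := ((PowerSeries.constantCoeff h : ℤ_[p]) : ℚ_[p]) with hh0_def
  set Shp : ℚ_[p] := (Nat.card (AddCommGroup.primaryComponent W.sha p) : ℚ_[p]) with hShp_def
  have key : c * PowerSeries.coeff (k + e) L * B =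
      h0 * (((u : ℤ_[p]) : ℚ_[p]) * ((A * R) * Shp)) := by
    have e1 : c * PowerSeries.coeff (k + e) L =
        h0 * ((PowerSeries.coeff k fE : ℤ_[p]) : ℚ_[p]) := by
      rw [hcoeff_cL, hcoeff_g, hcoeff_fE, hh0_def]; push_cast; ring
    calc c * PowerSeries.coeff (k + e) L * B
        = h0 * (((PowerSeries.coeff k fE : ℤ_[p]) : ℚ_[p]) * B) := by rw [e1]; ring
      _ = h0 * (((u : ℤ_[p]) : ℚ_[p]) * ((A * R) * Shp)) := by rw [hu, hShp_def]
  -- valuations: `v(A·R) = v(h0) + v(A·R) + v(#Ш)` with `v(h0), v(#Ш) ≥ 0`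
  have hh0ne : h0 ≠ 0 := by
    rw [hh0_def]; intro e0; exact hh0 (by exact_mod_cast (PadicInt.coe_eq_zero.mp e0))
  have hh0val : 0 ≤ h0.valuation := by rw [hh0_def]; exact PadicInt.valuation_coe_nonneg
  have hShp0 : Shp ≠ 0 := by rw [hShp_def]; exact_mod_cast Nat.card_pos.ne'
  have hvS : 0 ≤ Shp.valuation := by
    rw [hShp_def, Padic.valuation_natCast]; exact_mod_cast Nat.zero_le _
  have hAR0 : A * R ≠ 0 := mul_ne_zero hA hR
  have hval := congrArg Padic.valuation key
  rw [hcert, Padic.valuation_mul hh0ne (mul_ne_zero (coe_units_ne_zero p u) (mul_ne_zero hAR0 hShp0)),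
    Padic.valuation_mul (coe_units_ne_zero p u) (mul_ne_zero hAR0 hShp0),
    valuation_coe_units_eq_zero, zero_add, Padic.valuation_mul hAR0 hShp0] at hval
  have hvalh0 : h0.valuation = 0 := by linarith
  -- `h(0) ∈ ℤ_pˣ`, so `h ∈ Λˣ`
  have hvalh : (PowerSeries.constantCoeff h : ℤ_[p]).valuation = 0 := by
    have h' : (((PowerSeries.constantCoeff h : ℤ_[p]) : ℚ_[p])).valuation = 0 := by
      rw [← hh0_def]; exact hvalh0
    rw [PadicInt.valuation_coe] at h'
    exact_mod_cast h'
  have hunit0 : IsUnit (PowerSeries.constantCoeff h : ℤ_[p]) := by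
    rw [PadicInt.isUnit_iff, PadicInt.norm_eq_zpow_neg_valuation hh0, hvalh]
    simp
  exact ⟨PowerSeries.isUnit_iff_constantCoeff.mpr hunit0, hordfE⟩

/-! ## §2 Lever L3 ⟹ Mazur's main conjecture at the pair (raw hypotheses) -/

/-- **SPLIT `p ‖ N`, rank one, `E[p]` reducible: the L3 certificate ⟹ `X2.MazurMainConjectureAt W p`.**
Inputs BY NAME: Wuthrich 2014 Thm. 16 (`hWu`), Stein–Wuthrich 2013 Thm. 6.1 split (`hJs`), GZK (`hGZK`);
per pair: `p ≠ 2`, split, reducible, `r_an = 1`, and the certificate `hcert` for THE split Mazur–Tate–Teitelbaum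
function and THE §4.2 height — `ord_{T=0} L = 2 ∧ v_p(ϖ·[T²]L·log_p(γ_cyc)²·#tors²) = v_p(𝓛_p·∏c_v·Reg_p)` —
LITERALLY the `hcert` of `bsdp_of_cellC_of_split_of_thm16_of_l3Certificate`. No `#Ш_an`, no parity, no `(μ,λ)`.
[cite: Wuthrich2014, Thm. 16 (p. 397)] [cite: SteinWuthrich2013, Thm. 6.1 (p. 20), §4.2 and §8.2 (p. 24)] -/
theorem mazurMainConjectureAt_of_thm16_of_l3Certificate_split
    (hWu : thm16_charIdeal_dvd_multiplicative_of_reducible) (hJs : thm61_splitMultiplicative)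
    (hGZK : rank_eq_analyticRank_of_analyticRank_le_one)
    (hp2 : p ≠ 2) (hsplit : W.HasSplitMultiplicativeReductionAtPrime p)
    (hred : ¬ W.HasIrreducibleModPGaloisRep p) (hr1 : W.analyticRank = 1)
    (hcert : ∀ {N : ℕ} [NeZero N] (f : CuspForm (Gamma0 N) 2), IsNewformOf W f →
      ∀ (ϖ : ℚ), (ϖ : ℝ) * W.realPeriodRat = plusPeriod f →
      ∀ (L : PowerSeries ℚ_[p]), IsSplitMultPAdicLFunctionOf f p L →
      ∀ (Dq : TateParameterData W p) (Dh : PAdicHeightData W p), IsSplitMultCanonical Dh Dq →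
        L.order = ((2 : ℕ) : ℕ∞) ∧
        (((ϖ : ℚ) : ℚ_[p]) * PowerSeries.coeff 2 L *
            (padicLog p (cyclotomicGenerator p) ^ 2 * (W.torsionOrder : ℚ_[p]) ^ 2)).valuation =
          (LInvariant Dq * (W.tamagawaProduct : ℚ_[p]) * padicRegulator Dh).valuation) :
    X2.MazurMainConjectureAt W p := by
  intro κ γ hκ hγ hγ' N _ f hf D ϖ hϖ
  haveI : Module.Finite (IwasawaAlgebra p) D.X := D.module_finite_holds hγ
  obtain ⟨hX, -, hKs⟩ := hWu W p hp2 hsplit.hasMultiplicativeReductionAtPrime hred hκ hγ hγ' hf D ϖ hϖ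
  haveI : (Literature.NumberTheory.EllipticCurves.Module.charIdeal (IwasawaAlgebra p) D.X).IsPrincipal :=
    charIdeal_isPrincipal_holds p D.X
  obtain ⟨fE, hfE⟩ := Submodule.IsPrincipal.principal
    (Literature.NumberTheory.EllipticCurves.Module.charIdeal (IwasawaAlgebra p) D.X)
  have hchar : D.charIdeal = Ideal.span {fE} := hfE
  have hrank : W.mordellWeilRank = 1 := by rw [(hGZK W hr1.le).1, hr1]
  have hϖ0 : ϖ ≠ 0 := by
    rintro rfl
    have hper : 0 < plusPeriod f := IsNewform0.plusPeriod_pos_holds hf.1 hf.coeffField_eq_bot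
    rw [← hϖ, Rat.cast_zero, zero_mul] at hper
    exact lt_irrefl _ hper
  have hϖQ : ((ϖ : ℚ) : ℚ_[p]) ≠ 0 := by exact_mod_cast hϖ0
  refine ⟨hX, fE, hchar, fun hsplit' L hL ↦ ?_, fun hns _ _ ↦ absurd hsplit hns⟩
  obtain ⟨g, hgmem, hιg⟩ := hKs hsplit' L hL
  have hgmem' : g ∈ Ideal.span {fE} := by rw [← hchar]; exact hgmem
  obtain ⟨h, hgh⟩ := Ideal.mem_span_singleton'.mp hgmem'
  obtain ⟨Dq⟩ := (nonempty_tateParameterData_iff_holds (W := W) (p := p)).mpr hsplit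
  obtain ⟨Dh, hDh⟩ := exists_isSplitMultCanonical_holds W p hp2 Dq
  obtain ⟨hordL, hval⟩ := hcert f hf ϖ hϖ L hL Dq Dh hDh
  have hXk := X_pow_mordellWeilRank_dvd_of_charIdeal_eq_span W p hγ D hX hchar
  have h𝓛A : LInvariant Dq * (W.tamagawaProduct : ℚ_[p]) ≠ 0 :=
    mul_ne_zero (LInvariant_ne_zero_holds Dq) (by exact_mod_cast (W.tamagawaProduct_pos').ne')
  -- the engine shape `ϖ·L = T¹·ι(h·f_E)`
  have hι : PowerSeries.C ((ϖ : ℚ) : ℚ_[p]) * L =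
      PowerSeries.X ^ 1 * iwasawaToPowerSeries p (h * fE) := by
    rw [hgh, ← hιg, map_mul, pow_one]
    simp [iwasawaToPowerSeries, PowerSeries.map_X]
  obtain ⟨hunit, -⟩ := isUnit_cofactor_of_leadingTerm_certificate W p fE h L _ hϖQ 1
    W.mordellWeilRank hι (by rw [hrank]; exact hordL) _ _ (padicRegulator Dh) h𝓛A hXk
    (hJs.leadingTerm_shape hp2 Dq hκ hγ hγ' D hX hDh fE hchar) (by rw [hrank]; exact hval)
  refine ⟨hunit.unit, ?_⟩
  rw [IsUnit.unit_spec, mul_assoc, mul_comm fE h, hgh, hιg]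

/-- **NON-split `p ‖ N`, rank one, `E[p]` reducible: the L3 certificate ⟹ `X2.MazurMainConjectureAt W p`**
(as above with Stein–Wuthrich Thm. 6.1 non-split `hJn`, THE non-split function `IsMultPAdicLFunctionOf f p (-1) L`,
the Tate parameter `q` and THE §4.2 height for `q`; certificate `ord_{T=0} L = 1 ∧
v_p(ϖ·[T¹]L·log_p(γ_cyc)·#tors²) = v_p(2·∏c_v·Reg_p)` = the `hcert` of `bsdp_of_cellC_of_not_split_of_thm16_of_l3Certificate`).
[cite: Wuthrich2014, Thm. 16 (p. 397)] [cite: SteinWuthrich2013, Thm. 6.1 (p. 20), §3.1 (p. 9), §4.2 and §8.2 (p. 24)] -/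
theorem mazurMainConjectureAt_of_thm16_of_l3Certificate_nonsplit
    (hWu : thm16_charIdeal_dvd_multiplicative_of_reducible) (hJn : thm61_nonsplitMultiplicative)
    (hGZK : rank_eq_analyticRank_of_analyticRank_le_one)
    (hp2 : p ≠ 2) (hmult : W.HasMultiplicativeReductionAtPrime p)
    (hns : ¬ W.HasSplitMultiplicativeReductionAtPrime p)
    (hred : ¬ W.HasIrreducibleModPGaloisRep p) (hr1 : W.analyticRank = 1)
    (hcert : ∀ {N : ℕ} [NeZero N] (f : CuspForm (Gamma0 N) 2), IsNewformOf W f →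
      ∀ (ϖ : ℚ), (ϖ : ℝ) * W.realPeriodRat = plusPeriod f →
      ∀ (L : PowerSeries ℚ_[p]), IsMultPAdicLFunctionOf f p (-1) L →
      ∀ (q : ℚ_[p]), q ≠ 0 → ‖q‖ < 1 → tateJ q = (W.j : ℚ_[p]) →
      ∀ (Dh : PAdicHeightData W p), IsMultCanonical Dh q →
        L.order = ((1 : ℕ) : ℕ∞) ∧
        (((ϖ : ℚ) : ℚ_[p]) * PowerSeries.coeff 1 L *
            (padicLog p (cyclotomicGenerator p) ^ 1 * (W.torsionOrder : ℚ_[p]) ^ 2)).valuation =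
          (2 * (W.tamagawaProduct : ℚ_[p]) * padicRegulator Dh).valuation) :
    X2.MazurMainConjectureAt W p := by
  intro κ γ hκ hγ hγ' N _ f hf D ϖ hϖ
  haveI : Module.Finite (IwasawaAlgebra p) D.X := D.module_finite_holds hγ
  obtain ⟨hX, hKns, -⟩ := hWu W p hp2 hmult hred hκ hγ hγ' hf D ϖ hϖ
  haveI : (Literature.NumberTheory.EllipticCurves.Module.charIdeal (IwasawaAlgebra p) D.X).IsPrincipal :=
    charIdeal_isPrincipal_holds p D.X
  obtain ⟨fE, hfE⟩ := Submodule.IsPrincipal.principal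
    (Literature.NumberTheory.EllipticCurves.Module.charIdeal (IwasawaAlgebra p) D.X)
  have hchar : D.charIdeal = Ideal.span {fE} := hfE
  have hrank : W.mordellWeilRank = 1 := by rw [(hGZK W hr1.le).1, hr1]
  have hϖ0 : ϖ ≠ 0 := by
    rintro rfl
    have hper : 0 < plusPeriod f := IsNewform0.plusPeriod_pos_holds hf.1 hf.coeffField_eq_bot
    rw [← hϖ, Rat.cast_zero, zero_mul] at hper
    exact lt_irrefl _ hper
  have hϖQ : ((ϖ : ℚ) : ℚ_[p]) ≠ 0 := by exact_mod_cast hϖ0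
  refine ⟨hX, fE, hchar, fun hsplit _ _ ↦ absurd hsplit hns, fun hns' L hL ↦ ?_⟩
  obtain ⟨g, hgmem, hιg⟩ := hKns hns' L hL
  have hgmem' : g ∈ Ideal.span {fE} := by rw [← hchar]; exact hgmem
  obtain ⟨h, hgh⟩ := Ideal.mem_span_singleton'.mp hgmem'
  obtain ⟨q, ⟨hq0, hq1, hqj⟩, -⟩ := existsUnique_tateJ_eq_of_one_lt_norm
    (one_lt_norm_j_of_hasMultiplicativeReductionAtPrime (W := W) (p := p) hmult)
  obtain ⟨Dh, hDh⟩ := exists_isMultCanonical_holds W p hp2 hmult hns q hq0 hq1 hqj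
  obtain ⟨hordL, hval⟩ := hcert f hf ϖ hϖ L hL q hq0 hq1 hqj Dh hDh
  have hXk := X_pow_mordellWeilRank_dvd_of_charIdeal_eq_span W p hγ D hX hchar
  have h2A : (2 : ℚ_[p]) * (W.tamagawaProduct : ℚ_[p]) ≠ 0 :=
    mul_ne_zero two_ne_zero (by exact_mod_cast (W.tamagawaProduct_pos').ne')
  -- the engine shape `ϖ·L = T⁰·ι(h·f_E)`
  have hι : PowerSeries.C ((ϖ : ℚ) : ℚ_[p]) * L =
      PowerSeries.X ^ 0 * iwasawaToPowerSeries p (h * fE) := by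
    rw [hgh, pow_zero, one_mul, hιg]
  obtain ⟨hunit, -⟩ := isUnit_cofactor_of_leadingTerm_certificate W p fE h L _ hϖQ 0
    W.mordellWeilRank hι (by rw [hrank, Nat.add_zero]; exact hordL) _ _ (padicRegulator Dh) h2A hXk
    (hJn.leadingTerm_shape hp2 hmult hns hq0 hq1 hqj hκ hγ hγ' D hX hDh fE hchar)
    (by rw [hrank, Nat.add_zero]; exact hval)
  refine ⟨hunit.unit, ?_⟩
  rw [IsUnit.unit_spec, mul_comm fE h, hgh, hιg]

/-! ## §3 Cell forms on `X2.CellC W p`: the SAME readings as the p534013 doors give `BSD(E,p)` AND the main conjecture -/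

/-- **X2c, SPLIT `p ‖ N`: `CellC W p` ∧ split ∧ the L3 certificate ⟹ Mazur's main conjecture at the pair.**
[cite: Wuthrich2014, Thm. 16 (p. 397)] [cite: SteinWuthrich2013, Thm. 6.1 (p. 20) and §4.2] -/
theorem cellC_mazurMainConjectureAt_of_split_of_thm16_of_l3Certificate
    (hWu : thm16_charIdeal_dvd_multiplicative_of_reducible) (hJs : thm61_splitMultiplicative)
    (hGZK : rank_eq_analyticRank_of_analyticRank_le_one)
    (hc : CellC W p) (hsplit : W.HasSplitMultiplicativeReductionAtPrime p)
    (hcert : ∀ {N : ℕ} [NeZero N] (f : CuspForm (Gamma0 N) 2), IsNewformOf W f →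
      ∀ (ϖ : ℚ), (ϖ : ℝ) * W.realPeriodRat = plusPeriod f →
      ∀ (L : PowerSeries ℚ_[p]), IsSplitMultPAdicLFunctionOf f p L →
      ∀ (Dq : TateParameterData W p) (Dh : PAdicHeightData W p), IsSplitMultCanonical Dh Dq →
        L.order = ((2 : ℕ) : ℕ∞) ∧
        (((ϖ : ℚ) : ℚ_[p]) * PowerSeries.coeff 2 L *
            (padicLog p (cyclotomicGenerator p) ^ 2 * (W.torsionOrder : ℚ_[p]) ^ 2)).valuation =
          (LInvariant Dq * (W.tamagawaProduct : ℚ_[p]) * padicRegulator Dh).valuation) :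
    X2.MazurMainConjectureAt W p := by
  obtain ⟨hr1, hp2, hred, -⟩ := hc
  exact mazurMainConjectureAt_of_thm16_of_l3Certificate_split W p hWu hJs hGZK hp2 hsplit hred hr1 hcert

/-- **X2c, NON-split `p ‖ N`: `CellC W p` ∧ ¬split ∧ the L3 certificate ⟹ Mazur's main conjecture at the pair.**
[cite: Wuthrich2014, Thm. 16 (p. 397)] [cite: SteinWuthrich2013, Thm. 6.1 (p. 20), §3.1 (p. 9), §4.2] -/
theorem cellC_mazurMainConjectureAt_of_not_split_of_thm16_of_l3Certificate
    (hWu : thm16_charIdeal_dvd_multiplicative_of_reducible) (hJn : thm61_nonsplitMultiplicative)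
    (hGZK : rank_eq_analyticRank_of_analyticRank_le_one)
    (hc : CellC W p) (hns : ¬ W.HasSplitMultiplicativeReductionAtPrime p)
    (hcert : ∀ {N : ℕ} [NeZero N] (f : CuspForm (Gamma0 N) 2), IsNewformOf W f →
      ∀ (ϖ : ℚ), (ϖ : ℝ) * W.realPeriodRat = plusPeriod f →
      ∀ (L : PowerSeries ℚ_[p]), IsMultPAdicLFunctionOf f p (-1) L →
      ∀ (q : ℚ_[p]), q ≠ 0 → ‖q‖ < 1 → tateJ q = (W.j : ℚ_[p]) →
      ∀ (Dh : PAdicHeightData W p), IsMultCanonical Dh q →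
        L.order = ((1 : ℕ) : ℕ∞) ∧
        (((ϖ : ℚ) : ℚ_[p]) * PowerSeries.coeff 1 L *
            (padicLog p (cyclotomicGenerator p) ^ 1 * (W.torsionOrder : ℚ_[p]) ^ 2)).valuation =
          (2 * (W.tamagawaProduct : ℚ_[p]) * padicRegulator Dh).valuation) :
    X2.MazurMainConjectureAt W p := by
  obtain ⟨hr1, hp2, hred, hmult⟩ := hc
  exact mazurMainConjectureAt_of_thm16_of_l3Certificate_nonsplit W p hWu hJn hGZK hp2 hmult hns hred
    hr1 hcert

/-- **X2c, SPLIT `p ‖ N` — ONE certificate, TWO conclusions: `BSD(E,p)` (p534013 door) AND Mazur's main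
conjecture at the pair.** [cite: Wuthrich2014, Thm. 16 (p. 397)] [cite: SteinWuthrich2013, Thm. 6.1 (p. 20) and §4.2]
[cite: Miller2011LMS, Def. 1.1 and Prop. 7.6] -/
theorem bsdp_and_mazurMainConjectureAt_of_cellC_of_split_of_thm16_of_l3Certificate
    (hWu : thm16_charIdeal_dvd_multiplicative_of_reducible) (hJs : thm61_splitMultiplicative)
    (hGZ : GrossZagier1986_thm_I_7_3) (hGZK : rank_eq_analyticRank_of_analyticRank_le_one)
    (hpar : nonempty_modularParametrizationData)
    (hc : CellC W p) (hsplit : W.HasSplitMultiplicativeReductionAtPrime p)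
    (hcert : ∀ {N : ℕ} [NeZero N] (f : CuspForm (Gamma0 N) 2), IsNewformOf W f →
      ∀ (ϖ : ℚ), (ϖ : ℝ) * W.realPeriodRat = plusPeriod f →
      ∀ (L : PowerSeries ℚ_[p]), IsSplitMultPAdicLFunctionOf f p L →
      ∀ (Dq : TateParameterData W p) (Dh : PAdicHeightData W p), IsSplitMultCanonical Dh Dq →
        L.order = ((2 : ℕ) : ℕ∞) ∧
        (((ϖ : ℚ) : ℚ_[p]) * PowerSeries.coeff 2 L *
            (padicLog p (cyclotomicGenerator p) ^ 2 * (W.torsionOrder : ℚ_[p]) ^ 2)).valuation =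
          (LInvariant Dq * (W.tamagawaProduct : ℚ_[p]) * padicRegulator Dh).valuation)
    (hsha : ∀ s : ℚ, shaAn W = (s : ℂ) → padicValRat p s = 0) :
    BSDp W p ∧ X2.MazurMainConjectureAt W p :=
  ⟨bsdp_of_cellC_of_split_of_thm16_of_l3Certificate W p hWu hJs hGZ hGZK hpar hc hsplit hcert hsha,
    cellC_mazurMainConjectureAt_of_split_of_thm16_of_l3Certificate W p hWu hJs hGZK hc hsplit hcert⟩

/-- **X2c, NON-split `p ‖ N` — ONE certificate, TWO conclusions: `BSD(E,p)` AND Mazur's main conjecture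
at the pair.** [cite: Wuthrich2014, Thm. 16 (p. 397)] [cite: SteinWuthrich2013, Thm. 6.1 (p. 20), §3.1 (p. 9), §4.2]
[cite: Miller2011LMS, Def. 1.1 and Prop. 7.6] -/
theorem bsdp_and_mazurMainConjectureAt_of_cellC_of_not_split_of_thm16_of_l3Certificate
    (hWu : thm16_charIdeal_dvd_multiplicative_of_reducible) (hJn : thm61_nonsplitMultiplicative)
    (hGZ : GrossZagier1986_thm_I_7_3) (hGZK : rank_eq_analyticRank_of_analyticRank_le_one)
    (hpar : nonempty_modularParametrizationData)
    (hc : CellC W p) (hns : ¬ W.HasSplitMultiplicativeReductionAtPrime p)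
    (hcert : ∀ {N : ℕ} [NeZero N] (f : CuspForm (Gamma0 N) 2), IsNewformOf W f →
      ∀ (ϖ : ℚ), (ϖ : ℝ) * W.realPeriodRat = plusPeriod f →
      ∀ (L : PowerSeries ℚ_[p]), IsMultPAdicLFunctionOf f p (-1) L →
      ∀ (q : ℚ_[p]), q ≠ 0 → ‖q‖ < 1 → tateJ q = (W.j : ℚ_[p]) →
      ∀ (Dh : PAdicHeightData W p), IsMultCanonical Dh q →
        L.order = ((1 : ℕ) : ℕ∞) ∧
        (((ϖ : ℚ) : ℚ_[p]) * PowerSeries.coeff 1 L *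
            (padicLog p (cyclotomicGenerator p) ^ 1 * (W.torsionOrder : ℚ_[p]) ^ 2)).valuation =
          (2 * (W.tamagawaProduct : ℚ_[p]) * padicRegulator Dh).valuation)
    (hsha : ∀ s : ℚ, shaAn W = (s : ℂ) → padicValRat p s = 0) :
    BSDp W p ∧ X2.MazurMainConjectureAt W p :=
  ⟨bsdp_of_cellC_of_not_split_of_thm16_of_l3Certificate W p hWu hJn hGZ hGZK hpar hc hns hcert hsha,
    cellC_mazurMainConjectureAt_of_not_split_of_thm16_of_l3Certificate W p hWu hJn hGZK hc hns hcert⟩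

end Summit.BirchSwinnertonDyer.BirchSwinnertonDyer.Theorems.B11L3

end
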